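import Literature.Probability.RandomGraphs.PlantedCliqueEvents
import Literature.Probability.RandomMatrix.RandomSignMatrixNorm
import HarnessLib

/-!
# Planted clique: the probabilistic events of the AKS analysis, counting form (II)

The third bad event of the analysis of Alon–Krivelevich–Sudakov 1998 (§2.2 with §2.3), for a
fixed planted set `S`, a seed `S' ⊆ S` and the uniformly random remainder `x : EdgeVec n`:
the random part of the sign matrix of the common neighbourhood `V'₀ = seedNbhd S S' x` of the
seed (the vertices off `S'` adjacent to all of `S'`) is large in bilinear form.

* `seedNbhd`, its structure (`seedNbhd_eq_union`: `V'₀ = (S ∖ S') ∪ {v ∉ S : v ~ S'}`) and its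
  dependence on the edges between `Sᶜ` and `S'` only (`seedNbhd_eq_of_agree`);
* `Rmat S V₀ x` — the random part, on the positions `Fin |V₀|` of a vertex set `V₀` (through
  `Finset.orderEmbOfFin`): `0` on the diagonal and on `S × S`, otherwise `±1` by adjacency;
  `badNormAt S V₀` — the `x` with `¬ ∀ a b, Σ Rᵢⱼ aᵢ bⱼ ≤ 12 √|V₀| ‖a‖ ‖b‖`, of size
  `≤ e^{-4|V₀|} 2^{#E}` (`card_badNormAt_le`, from
  `Literature.Probability.RandomMatrix.card_filter_not_bilin_le_le`);
* `badNorm S S'` — bad at one's own common neighbourhood — of size `≤ e^{-4|S ∖ S'|} 2^{#E}`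
  (`card_badNorm_le`): AKS's conditioning "expose the edges from `S` to `V ∖ S` thus fixing
  `N*(S)`, and then expose all the edges inside `N*(S)`" is the product rule
  `Literature.Probability.Moments.card_filter_and_mul_eq` over the fibres `{seedNbhd = V₀}`.

## References

* N. Alon, M. Krivelevich, B. Sudakov, *Finding a large hidden clique in a random graph*, Random
  Structures Algorithms 13 (1998) 457–466, §2.2–2.3 [AlonKrivelevichSudakov1998].
-/

noncomputable section

open Finset Real

namespace Literature.Probability.RandomGraphs.PlantedClique

open Literature.Probability.Moments Literature.Probability.RandomMatrix

variable {n : ℕ}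

/-! ### The common neighbourhood of the seed -/

/-- `V'₀ = N*(S') ∖ S'`: the vertices off the seed adjacent to every vertex of the seed.
[cite: AlonKrivelevichSudakov1998, §2.3 (`N*(S)`)] -/
def seedNbhd (S S' : Finset (Fin n)) (x : EdgeVec n) : Finset (Fin n) :=
  open scoped Classical in
  univ.filter fun v => v ∉ S' ∧ ∀ w ∈ S', (graphOfEdgeVec (plant S x)).Adj v w

/-- Membership in the common neighbourhood. [folklore] -/
theorem mem_seedNbhd {S S' : Finset (Fin n)} {x : EdgeVec n} {v : Fin n} :
    v ∈ seedNbhd S S' x ↔ v ∉ S' ∧ ∀ w ∈ S', (graphOfEdgeVec (plant S x)).Adj v w := by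
  simp [seedNbhd]

/-- **Structure of the common neighbourhood**: for a seed inside the planted clique,
`V'₀ = (S ∖ S') ∪ {v ∉ S : v ~ S'}`. [cite: AlonKrivelevichSudakov1998, §2.3 ("The addition of a clique of size `k` can increase `|N*(S)|` only by at most `k - s`")] -/
theorem seedNbhd_eq_union {S S' : Finset (Fin n)} (hS'S : S' ⊆ S) (x : EdgeVec n) :
    seedNbhd S S' x = (S \ S') ∪
      (open scoped Classical in
        (univ \ S).filter fun v => ∀ w ∈ S', (graphOfEdgeVec (plant S x)).Adj v w) := by
  classical
  ext v
  rw [mem_seedNbhd, mem_union, mem_sdiff, mem_filter, mem_sdiff]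
  constructor
  · rintro ⟨hvS', hadj⟩
    by_cases hvS : v ∈ S
    · exact Or.inl ⟨hvS, hvS'⟩
    · exact Or.inr ⟨⟨mem_univ _, hvS⟩, hadj⟩
  · rintro (⟨hvS, hvS'⟩ | ⟨⟨-, hvS⟩, hadj⟩)
    · refine ⟨hvS', fun w hw => ?_⟩
      have hvw : v ≠ w := fun h => hvS' (h ▸ hw)
      exact isClique_plant S x hvS (hS'S hw) hvw
    · exact ⟨fun h => hvS (hS'S h), hadj⟩

/-- The common neighbourhood contains `S ∖ S'` and misses `S'`. [folklore] -/
theorem sdiff_subset_seedNbhd {S S' : Finset (Fin n)} (hS'S : S' ⊆ S) (x : EdgeVec n) :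
    S \ S' ⊆ seedNbhd S S' x := by
  rw [seedNbhd_eq_union hS'S]; exact subset_union_left

/-- The common neighbourhood misses the seed. [folklore] -/
theorem disjoint_seedNbhd {S S' : Finset (Fin n)} (x : EdgeVec n) : Disjoint (seedNbhd S S' x) S' :=
  Finset.disjoint_left.2 fun _ hv hv' => (mem_seedNbhd.1 hv).1 hv'

/-- Its size: `|V'₀| = |S ∖ S'| + #{v ∉ S : v ~ S'}`. [folklore] -/
theorem card_seedNbhd {S S' : Finset (Fin n)} (hS'S : S' ⊆ S) (x : EdgeVec n) :
    (seedNbhd S S' x).card = (S \ S').card + outsideNbrCount S S' x := by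
  classical
  rw [seedNbhd_eq_union hS'S, card_union_of_disjoint, outsideNbrCount]
  exact Finset.disjoint_left.2 fun v hv hv' => (mem_sdiff.1 (mem_filter.1 hv').1).2 (mem_sdiff.1 hv).1

/-- The edges between `Sᶜ` and the seed. [folklore] -/
def crossSet (S S' : Finset (Fin n)) : Finset (⊤ : SimpleGraph (Fin n)).edgeSet :=
  univ.filter fun e => ∃ v, v ∉ S ∧ ∃ w ∈ S', (e : Sym2 (Fin n)) = s(v, w)

/-- **`V'₀` is determined by the edges between `Sᶜ` and the seed** (AKS: "expose the edges from
`S` to `V ∖ S` thus fixing `N*(S)`"). [cite: AlonKrivelevichSudakov1998, §2.3] -/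
theorem seedNbhd_eq_of_agree {S S' : Finset (Fin n)} (hS'S : S' ⊆ S) {x x' : EdgeVec n}
    (h : ∀ e ∈ crossSet S S', x e = x' e) : seedNbhd S S' x = seedNbhd S S' x' := by
  classical
  rw [seedNbhd_eq_union hS'S x, seedNbhd_eq_union hS'S x']
  congr 1
  refine filter_congr fun v hv => ?_
  rw [mem_sdiff] at hv
  refine forall₂_congr fun w hw => ?_
  have hvw : v ≠ w := fun h' => hv.2 (h' ▸ hS'S hw)
  rw [adj_plant_iff_of_not_mem x hv.2 hvw, adj_plant_iff_of_not_mem x' hv.2 hvw, h]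
  exact mem_filter.2 ⟨mem_univ _, v, hv.2, w, hw, rfl⟩

/-! ### The random part of the sign matrix on a vertex set -/

/-- The random part `R` of the sign matrix of the planted graph on the positions of a vertex set
`V₀` (listed increasingly by `Finset.orderEmbOfFin`): `0` on the diagonal and when both vertices
are planted, otherwise `+1`/`-1` by adjacency. [cite: AlonKrivelevichSudakov1998, §2.2 (the random graphs `A₁`, `G₁`)] -/
def Rmat (S V₀ : Finset (Fin n)) (x : EdgeVec n) (i j : Fin V₀.card) : ℝ :=
  open scoped Classical in
  if i = j ∨ ((V₀.orderEmbOfFin rfl i : Fin n) ∈ S ∧ (V₀.orderEmbOfFin rfl j : Fin n) ∈ S) then 0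
  else if (graphOfEdgeVec (plant S x)).Adj (V₀.orderEmbOfFin rfl i) (V₀.orderEmbOfFin rfl j)
    then 1 else -1

/-- The bad norm event at a vertex set `V₀`, `m = |V₀|`: the bilinear form of `R` exceeds
`12 √m ‖a‖ ‖b‖` somewhere. [cite: AlonKrivelevichSudakov1998, §2.2 (Lemma 2.2, the norm of the random part)] -/
def badNormAt (S V₀ : Finset (Fin n)) : Finset (EdgeVec n) :=
  open scoped Classical in
  univ.filter fun x => ¬ ∀ a b : EuclideanSpace ℝ (Fin V₀.card),
    ∑ i, ∑ j, Rmat S V₀ x i j * a i * b j ≤ 12 * Real.sqrt V₀.card * ‖a‖ * ‖b‖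

/-- The bad norm event: bad at one's own common neighbourhood of the seed.
[cite: AlonKrivelevichSudakov1998, §2.2–2.3] -/
def badNorm (S S' : Finset (Fin n)) : Finset (EdgeVec n) :=
  open scoped Classical in
  univ.filter fun x => x ∈ badNormAt S (seedNbhd S S' x)

/-- Adjacency of two listed vertices not both planted is the bit of their edge. [folklore] -/
theorem adj_iff_bit_of_not_both {S : Finset (Fin n)} (x : EdgeVec n) {u v : Fin n} (huv : u ≠ v)
    (hS : ¬ (u ∈ S ∧ v ∈ S)) :
    (graphOfEdgeVec (plant S x)).Adj u v ↔ x ⟨s(u, v), by simpa using huv⟩ = true := by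
  by_cases hu : u ∈ S
  · have hv : v ∉ S := fun hv => hS ⟨hu, hv⟩
    rw [SimpleGraph.adj_comm, adj_plant_iff_of_not_mem x hv huv.symm]
    have : (⟨s(v, u), by simpa using huv.symm⟩ : (⊤ : SimpleGraph (Fin n)).edgeSet) =
        ⟨s(u, v), by simpa using huv⟩ := Subtype.ext Sym2.eq_swap
    rw [this]
  · exact adj_plant_iff_of_not_mem x hu huv

/-- **The bad norm event at a fixed vertex set is small**: `#badNormAt S V₀ ≤ e^{-4|V₀|} 2^{#E}`
for `V₀` nonempty — the `ε`-net bound for the random sign matrix driven by the edge bits.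
[cite: AlonKrivelevichSudakov1998, §2.2 (Lemma 2.2)] -/
theorem card_badNormAt_le (S V₀ : Finset (Fin n)) (hm : 1 ≤ V₀.card) :
    ((badNormAt S V₀).card : ℝ) ≤
      Real.exp (-(4 * V₀.card)) * 2 ^ Fintype.card (⊤ : SimpleGraph (Fin n)).edgeSet := by
  classical
  set L := V₀.orderEmbOfFin rfl with hL
  -- the labelling of the entries by edge bits
  let lab : Fin V₀.card → Fin V₀.card → Option (⊤ : SimpleGraph (Fin n)).edgeSet := fun i j =>
    if h : i = j ∨ ((L i : Fin n) ∈ S ∧ (L j : Fin n) ∈ S) then none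
    else some ⟨s(L i, L j), by
      have hij : i ≠ j := fun h' => h (Or.inl h')
      simpa using L.injective.ne hij⟩
  have hlab_none : ∀ i j, lab i j = none ↔ (i = j ∨ ((L i : Fin n) ∈ S ∧ (L j : Fin n) ∈ S)) := by
    intro i j
    simp only [lab]
    split_ifs with h <;> simp [h]
  have hlab_some : ∀ i j e, lab i j = some e →
      ¬ (i = j ∨ ((L i : Fin n) ∈ S ∧ (L j : Fin n) ∈ S)) ∧ (e : Sym2 (Fin n)) = s(L i, L j) := by
    intro i j e he
    simp only [lab] at he
    split_ifs at he with h
    exact ⟨h, by rw [← Option.some.inj he]⟩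
  have hinj : ∀ i j i' j' e, lab i j = some e → lab i' j' = some e →
      (i = i' ∧ j = j') ∨ (i = j' ∧ j = i') := by
    intro i j i' j' e he he'
    obtain ⟨-, h1⟩ := hlab_some i j e he
    obtain ⟨-, h2⟩ := hlab_some i' j' e he'
    rw [h1, Sym2.eq_iff] at h2
    rcases h2 with ⟨ha, hb⟩ | ⟨ha, hb⟩
    · exact Or.inl ⟨L.injective ha, L.injective hb⟩
    · exact Or.inr ⟨L.injective ha, L.injective hb⟩
  have h0 : ∀ x i j, lab i j = none → Rmat S V₀ x i j = 0 := by
    intro x i j hij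
    rw [hlab_none] at hij
    simp only [Rmat, ← hL]
    rw [if_pos hij]
  have h1 : ∀ x i j e, lab i j = some e → Rmat S V₀ x i j = if x e then 1 else -1 := by
    intro x i j e he
    obtain ⟨hne, hev⟩ := hlab_some i j e he
    have hij : i ≠ j := fun h' => hne (Or.inl h')
    have hLij : (L i : Fin n) ≠ L j := L.injective.ne hij
    have hS : ¬ ((L i : Fin n) ∈ S ∧ (L j : Fin n) ∈ S) := fun h' => hne (Or.inr h')
    have hadj := adj_iff_bit_of_not_both x hLij hS
    have hedge : (⟨s(L i, L j), by simpa using hLij⟩ : (⊤ : SimpleGraph (Fin n)).edgeSet) = e :=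
      Subtype.ext hev.symm
    rw [hedge] at hadj
    simp only [Rmat, ← hL]
    rw [if_neg hne]
    by_cases hx : x e = true
    · rw [if_pos (hadj.2 hx), if_pos hx]
    · rw [if_neg (fun h' => hx (hadj.1 h')), if_neg hx]
  have h := card_filter_not_bilin_le_le lab hinj (Rmat S V₀) h0 h1
    (by rw [Fintype.card_fin]; exact hm)
  rw [Fintype.card_fin] at h
  refine le_trans (le_of_eq ?_) h
  unfold badNormAt
  congr 2

/-- The edges inside a vertex set that are not inside the planted set. [folklore] -/
def innerSet (S V₀ : Finset (Fin n)) : Finset (⊤ : SimpleGraph (Fin n)).edgeSet :=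
  open scoped Classical in
  univ.filter fun e => (∀ z ∈ (e : Sym2 (Fin n)), z ∈ V₀) ∧ ¬ ∀ z ∈ (e : Sym2 (Fin n)), z ∈ S

/-- `R` depends only on the inner edges of `V₀`. [folklore] -/
theorem Rmat_eq_of_agree {S V₀ : Finset (Fin n)} {x x' : EdgeVec n}
    (h : ∀ e ∈ innerSet S V₀, x e = x' e) : Rmat S V₀ x = Rmat S V₀ x' := by
  classical
  funext i j
  simp only [Rmat]
  by_cases hc : i = j ∨ ((V₀.orderEmbOfFin rfl i : Fin n) ∈ S ∧ (V₀.orderEmbOfFin rfl j : Fin n) ∈ S)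
  · rw [if_pos hc, if_pos hc]
  · rw [if_neg hc, if_neg hc]
    have hij : i ≠ j := fun h' => hc (Or.inl h')
    have hLij : (V₀.orderEmbOfFin rfl i : Fin n) ≠ V₀.orderEmbOfFin rfl j :=
      (V₀.orderEmbOfFin rfl).injective.ne hij
    have hS : ¬ ((V₀.orderEmbOfFin rfl i : Fin n) ∈ S ∧ (V₀.orderEmbOfFin rfl j : Fin n) ∈ S) :=
      fun h' => hc (Or.inr h')
    have he : (⟨s(V₀.orderEmbOfFin rfl i, V₀.orderEmbOfFin rfl j), by simpa using hLij⟩ :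
        (⊤ : SimpleGraph (Fin n)).edgeSet) ∈ innerSet S V₀ := by
      refine mem_filter.2 ⟨mem_univ _, ?_, ?_⟩
      · intro z hz
        rcases Sym2.mem_iff.1 hz with rfl | rfl <;> exact Finset.orderEmbOfFin_mem _ _ _
      · intro hall
        exact hS ⟨hall _ (Sym2.mem_mk_left _ _), hall _ (Sym2.mem_mk_right _ _)⟩
    rw [adj_iff_bit_of_not_both x hLij hS, adj_iff_bit_of_not_both x' hLij hS, h _ he]

/-- The bad norm event at `V₀` is determined by the inner edges of `V₀` (AKS: "and then expose all
the edges inside `N*(S)`"). [cite: AlonKrivelevichSudakov1998, §2.3] -/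
theorem mem_badNormAt_iff_of_agree {S V₀ : Finset (Fin n)} {x x' : EdgeVec n}
    (h : ∀ e ∈ innerSet S V₀, x e = x' e) : x ∈ badNormAt S V₀ ↔ x' ∈ badNormAt S V₀ := by
  simp only [badNormAt, mem_filter, mem_univ, true_and, Rmat_eq_of_agree h]

/-- The cross edges and the inner edges of a set missing the seed are disjoint. [folklore] -/
theorem disjoint_crossSet_innerSet {S S' V₀ : Finset (Fin n)} (hV₀ : Disjoint V₀ S') :
    Disjoint (crossSet S S') (innerSet S V₀) := by
  classical
  rw [Finset.disjoint_left]
  intro e he he'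
  obtain ⟨v, -, w, hw, hvw⟩ := (mem_filter.1 he).2
  obtain ⟨hall, -⟩ := (mem_filter.1 he').2
  have hwV : w ∈ V₀ := hall w (by rw [hvw]; exact Sym2.mem_mk_right v w)
  exact Finset.disjoint_left.1 hV₀ hwV hw

/-- **The bad norm event is small**: for a seed `S' ⊆ S` with `S ∖ S'` nonempty,
`#badNorm S S' ≤ e^{-4|S ∖ S'|} · 2^{#E}` — the conditioning step of AKS §2.3 as the product rule
over the fibres of `seedNbhd`. [cite: AlonKrivelevichSudakov1998, §2.3 ("`G[N*(S)]` can be treated as a truly random graph `G(|N*(S)|, 1/2, k-s)`")] -/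
theorem card_badNorm_le {S S' : Finset (Fin n)} (hS'S : S' ⊆ S) (hκ : 1 ≤ (S \ S').card) :
    ((badNorm S S').card : ℝ) ≤
      Real.exp (-(4 * (S \ S').card)) * 2 ^ Fintype.card (⊤ : SimpleGraph (Fin n)).edgeSet := by
  classical
  set E2 : ℝ := 2 ^ Fintype.card (⊤ : SimpleGraph (Fin n)).edgeSet with hE2
  have hE2pos : 0 < E2 := by rw [hE2]; positivity
  set κ := (S \ S').card with hκdef
  -- fibre of `seedNbhd` at `V₀`
  set fib : Finset (Fin n) → Finset (EdgeVec n) := fun V₀ =>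
    univ.filter fun x => seedNbhd S S' x = V₀ with hfib
  -- the bad event is covered by the bad parts of the fibres
  have hcover : badNorm S S' ⊆ (univ : Finset (Finset (Fin n))).biUnion fun V₀ =>
      univ.filter fun x => seedNbhd S S' x = V₀ ∧ x ∈ badNormAt S V₀ := by
    intro x hx
    rw [badNorm, mem_filter] at hx
    exact mem_biUnion.2 ⟨seedNbhd S S' x, mem_univ _, mem_filter.2 ⟨mem_univ _, rfl, hx.2⟩⟩
  -- each bad part is at most `e^{-4κ}` times its fibre
  have hpart : ∀ V₀ : Finset (Fin n),
      ((univ.filter fun x => seedNbhd S S' x = V₀ ∧ x ∈ badNormAt S V₀).card : ℝ) ≤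
        (fib V₀).card * Real.exp (-(4 * κ)) := by
    intro V₀
    by_cases hgood : S \ S' ⊆ V₀ ∧ Disjoint V₀ S'
    · -- product rule on the fibre
      have hind := card_filter_and_mul_eq (disjoint_crossSet_innerSet (S := S) hgood.2)
        (fun x => seedNbhd S S' x = V₀) (fun x => x ∈ badNormAt S V₀)
        (fun x x' hx => by rw [seedNbhd_eq_of_agree hS'S hx])
        (fun x x' hx => mem_badNormAt_iff_of_agree hx)
      have hm : 1 ≤ V₀.card := hκ.trans (card_le_card hgood.1)
      have hbad := card_badNormAt_le S V₀ hm
      have hκm : Real.exp (-(4 * V₀.card : ℝ)) ≤ Real.exp (-(4 * κ : ℝ)) := by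
        apply Real.exp_le_exp.2
        have : (κ : ℝ) ≤ V₀.card := by exact_mod_cast card_le_card hgood.1
        linarith
      have hkey : ((univ.filter fun x => seedNbhd S S' x = V₀ ∧ x ∈ badNormAt S V₀).card : ℝ) * E2
          ≤ (fib V₀).card * Real.exp (-(4 * κ)) * E2 := by
        rw [hE2, hind]
        have hf2 : (univ.filter fun x => x ∈ badNormAt S V₀) = badNormAt S V₀ := by ext x; simp
        calc ((univ.filter fun x => seedNbhd S S' x = V₀).card : ℝ) *
              (univ.filter fun x => x ∈ badNormAt S V₀).card
            = (fib V₀).card * (badNormAt S V₀).card := by rw [hf2]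
          _ ≤ (fib V₀).card * (Real.exp (-(4 * V₀.card)) *
              2 ^ Fintype.card (⊤ : SimpleGraph (Fin n)).edgeSet) := by gcongr
          _ ≤ (fib V₀).card * (Real.exp (-(4 * κ)) *
              2 ^ Fintype.card (⊤ : SimpleGraph (Fin n)).edgeSet) := by gcongr
          _ = (fib V₀).card * Real.exp (-(4 * κ)) *
              2 ^ Fintype.card (⊤ : SimpleGraph (Fin n)).edgeSet := by ring
      exact le_of_mul_le_mul_right hkey hE2pos
    · -- the fibre is empty
      have hempty : (univ.filter fun x => seedNbhd S S' x = V₀ ∧ x ∈ badNormAt S V₀) = ∅ := by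
        refine filter_eq_empty_iff.2 fun x _ h => hgood ?_
        rw [← h.1]
        exact ⟨sdiff_subset_seedNbhd hS'S x, disjoint_seedNbhd x⟩
      rw [hempty, card_empty, Nat.cast_zero]
      positivity
  -- the fibres partition the cube
  have hsum : ∑ V₀ : Finset (Fin n), ((fib V₀).card : ℝ) = E2 := by
    have h := card_eq_sum_card_fiberwise (s := (univ : Finset (EdgeVec n))) (t := univ)
      (f := seedNbhd S S') fun x _ => mem_univ _
    rw [card_univ, Fintype.card_fun, Fintype.card_bool] at h
    rw [hE2]
    have h' : ((2 ^ Fintype.card (⊤ : SimpleGraph (Fin n)).edgeSet : ℕ) : ℝ) =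
        ∑ V₀ : Finset (Fin n), ((fib V₀).card : ℝ) := by
      rw [h]; push_cast; rfl
    rw [← h']; push_cast; rfl
  calc ((badNorm S S').card : ℝ)
      ≤ (((univ : Finset (Finset (Fin n))).biUnion fun V₀ =>
          univ.filter fun x => seedNbhd S S' x = V₀ ∧ x ∈ badNormAt S V₀).card : ℝ) := by
        exact_mod_cast card_le_card hcover
    _ ≤ ∑ V₀ : Finset (Fin n),
          ((univ.filter fun x => seedNbhd S S' x = V₀ ∧ x ∈ badNormAt S V₀).card : ℝ) := by
        exact_mod_cast card_biUnion_le
    _ ≤ ∑ V₀ : Finset (Fin n), (fib V₀).card * Real.exp (-(4 * κ)) := sum_le_sum fun V₀ _ => hpart V₀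
    _ = Real.exp (-(4 * κ)) * E2 := by rw [← sum_mul, hsum, mul_comm]

end Literature.Probability.RandomGraphs.PlantedClique

end
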